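import Mathlib
import Summits.FinalStateConjecture.FinalStateConjecture.Theorems.StarvedNecksNecksCertifyStubNoParkingDecayHelpers

/-!
# Route StarvedNecks — crux `NecksCertify`, line `bargmann-small-late-exterior`: rung M2

Stub `stub_noParkingDecay` (statement `TonelliBargmann → CharacteristicCalculus → NoParkingDecay`
of the line skeleton, verbatim): RATE-FREE NO-PARKING in the late retarded region.  In the
setting of the sup-norm contraction (`|V| ≤ ν(r)` with Bargmann norm `∫ (s − R₀) ν < 1`, `ψ`
solving `ψ_tt − ψ_rr + Vψ = 0` and `χ` the free field with the same slab data and cylinder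
trace, `|ψ| ≤ P` on `Ω = {T ≤ t} × {R₀ ≤ r}`): if `χ` is eventually small beyond every retarded
time then so are `ψ` and both first derivatives of `ψ − χ`.

Proof (bookkeeping only; the calculus is hypothesis 2, the measure theory hypothesis 1).  With
the retarded-time supremum `N(u) = sup {|ψ(t,r)| : (t,r) ∈ Ω, u ≤ t − r}` (antitone, `0 ≤ N ≤ P`):

* incoming estimate (`w_estimate` of the helper file): the source points of
  `w = (∂ₜ + ∂ᵣ)(ψ − χ)` at parameter `s ≤ L` have retarded time `≥ u₀ − 2L`, so
  `|w(t,r)| ≤ N(u₀ − 2L) ∫_{(r,∞)} ν + P ∫_{(r+L,∞)} ν` (`w_key`);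
* outgoing estimate (`phi_estimate` of the helper file) and the double-integral bound of
  hypothesis 1: `|φ(t,r)| ≤ N(u₀ − 2L) η₀ + P τ(L)`, `η₀ = ∫ (s − R₀)ν < 1`,
  `τ(L) = ∫_{(R₀+L,∞)} (s − R₀)ν → 0` (`phi_key`);
* hence `ℓ = inf N` satisfies `ℓ ≤ 2δ + (ℓ + δ) η₀` for every `δ > 0`, so `ℓ = 0` (`sup_decay`);
* finally `|w| ≤ N(u₀ − 2L) ‖ν‖₁ + P ∫_{(R₀+L,∞)} ν` and `|z| ≤ |w(foot)| + N(u₀) ‖ν‖₁`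
  (`z_estimate` of the helper file), and `φ_t = (w + z)/2`, `φ_r = (w − z)/2`.

Mathlib and the helper file `StarvedNecksNecksCertifyStubNoParkingDecayHelpers` only; no named
facts.
-/

noncomputable section

namespace Summit.FinalStateConjecture.FinalStateConjecture.Theorems.NecksCertifyBargmann.NoParking

open Filter Topology MeasureTheory Set Function
open scoped Topology

/-- **Incoming estimate with the retarded-time supremum.**  For `(t, r) ∈ Ω` with `u₀ ≤ t - r`
and `L ≥ 0`: `|w t r| ≤ N (u₀ - 2L) ∫_{(r,∞)} ν + P ∫_{(r+L,∞)} ν` (the source points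
`(t - s, r + s)`, `s ≤ L`, have retarded time `t - r - 2s ≥ u₀ - 2L`). -/
theorem w_key {T R₀ P : ℝ} {ν : ℝ → ℝ} {ψ w D : ℝ → ℝ → ℝ} {N : ℝ → ℝ}
    (hν : ContinuousOn ν (Ici R₀)) (hνnn : ∀ s, R₀ ≤ s → 0 ≤ ν s)
    (hνint : IntegrableOn ν (Ioi R₀))
    (hDc : Continuous (uncurry D))
    (hDν : ∀ t r, T ≤ t → R₀ ≤ r → |D t r| ≤ ν r * |ψ t r|)
    (hP : ∀ t r, T ≤ t → R₀ ≤ r → |ψ t r| ≤ P)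
    (hin : ∀ t r a : ℝ, w t r = w (t - a) (r + a) + ∫ s in (0 : ℝ)..a, D (t - s) (r + s))
    (hwslab : ∀ r, R₀ ≤ r → w T r = 0)
    (hN : ∀ u t r, T ≤ t → R₀ ≤ r → u ≤ t - r → |ψ t r| ≤ N u)
    {u₀ L t r : ℝ} (hL : 0 ≤ L) (ht : T ≤ t) (hr : R₀ ≤ r) (hu : u₀ ≤ t - r) :
    |w t r| ≤ N (u₀ - 2 * L) * (∫ s in Ioi r, ν s) + P * ∫ s in Ioi (r + L), ν s :=
  w_estimate hν hνnn hνint hDc hDν hP hin hwslab ht hr hL fun s hs ↦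
    hN _ _ _ (by linarith [hs.2, min_le_right L (t - T)]) (by linarith [hs.1])
      (by linarith [hs.2, min_le_left L (t - T)])

/-- **Outgoing estimate with the retarded-time supremum.**  For `(t, r) ∈ Ω` with `u₀ ≤ t - r`
and `L ≥ 0`: `|φ t r| ≤ N (u₀ - 2L) ∫_{(R₀,∞)} (s - R₀) ν + P ∫_{(R₀+L,∞)} (s - R₀) ν`.  The
source points `(t - σ, r - σ)` of the outgoing identity all have retarded time `t - r ≥ u₀`, so
`w_key` bounds `|w|` there by the antitone weight
`G(ρ) = N(u₀ - 2L) ∫_{(ρ,∞)} ν + P ∫_{(ρ+L,∞)} ν`, and `∫_{R₀}^{r} G` is controlled by the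
double-integral bound of the Tonelli rung (with `L := 0` and with `L`). -/
theorem phi_key {T R₀ P : ℝ} {ν : ℝ → ℝ} {ψ φ w D : ℝ → ℝ → ℝ} {N : ℝ → ℝ}
    (hν : ContinuousOn ν (Ici R₀)) (hνnn : ∀ s, R₀ ≤ s → 0 ≤ ν s)
    (hνint : IntegrableOn ν (Ioi R₀))
    (hwc : Continuous (uncurry w)) (hDc : Continuous (uncurry D))
    (hDν : ∀ t r, T ≤ t → R₀ ≤ r → |D t r| ≤ ν r * |ψ t r|)
    (hP : ∀ t r, T ≤ t → R₀ ≤ r → |ψ t r| ≤ P)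
    (hin : ∀ t r a : ℝ, w t r = w (t - a) (r + a) + ∫ s in (0 : ℝ)..a, D (t - s) (r + s))
    (hout : ∀ t r a : ℝ, φ t r = φ (t - a) (r - a) + ∫ s in (0 : ℝ)..a, w (t - s) (r - s))
    (hwslab : ∀ r, R₀ ≤ r → w T r = 0) (hφslab : ∀ r, R₀ ≤ r → φ T r = 0)
    (hφcyl : ∀ t, T ≤ t → φ t R₀ = 0)
    (hIanti : ∀ L, 0 ≤ L → AntitoneOn (fun ρ ↦ ∫ s in Ioi (ρ + L), ν s) (Ici R₀))
    (hdouble : ∀ L r, 0 ≤ L → R₀ ≤ r →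
      ∫ ρ in R₀..r, (∫ s in Ioi (ρ + L), ν s) ≤ ∫ s in Ioi (R₀ + L), (s - R₀) * ν s)
    (hN : ∀ u t r, T ≤ t → R₀ ≤ r → u ≤ t - r → |ψ t r| ≤ N u) (hNnn : ∀ u, 0 ≤ N u)
    {u₀ L t r : ℝ} (hL : 0 ≤ L) (ht : T ≤ t) (hr : R₀ ≤ r) (hu : u₀ ≤ t - r) :
    |φ t r| ≤ N (u₀ - 2 * L) * (∫ s in Ioi R₀, (s - R₀) * ν s) +
      P * ∫ s in Ioi (R₀ + L), (s - R₀) * ν s := by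
  have hP0 : 0 ≤ P := (abs_nonneg _).trans (hP t r ht hr)
  have hM0 : 0 ≤ N (u₀ - 2 * L) := hNnn _
  -- the two tails and the weight `G`
  have hI0anti : AntitoneOn (fun ρ ↦ ∫ s in Ioi ρ, ν s) (Ici R₀) := by
    simpa only [add_zero] using hIanti 0 le_rfl
  have hILanti : AntitoneOn (fun ρ ↦ ∫ s in Ioi (ρ + L), ν s) (Ici R₀) := hIanti L hL
  have hI0nn : ∀ ρ, R₀ ≤ ρ → 0 ≤ ∫ s in Ioi ρ, ν s := fun ρ hρ ↦
    setIntegral_nonneg measurableSet_Ioi fun s (hs : ρ < s) ↦ hνnn s (by linarith)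
  have hILnn : ∀ ρ, R₀ ≤ ρ → 0 ≤ ∫ s in Ioi (ρ + L), ν s := fun ρ hρ ↦
    setIntegral_nonneg measurableSet_Ioi fun s (hs : ρ + L < s) ↦ hνnn s (by linarith)
  have hGanti : AntitoneOn
      (fun ρ ↦ N (u₀ - 2 * L) * (∫ s in Ioi ρ, ν s) + P * ∫ s in Ioi (ρ + L), ν s) (Ici R₀) := by
    intro x hx y hy hxy
    have h1 := hI0anti hx hy hxy
    have h2 := hILanti hx hy hxy
    simp only at h1 h2 ⊢
    gcongr
  have hGnn : ∀ ρ, R₀ ≤ ρ →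
      0 ≤ N (u₀ - 2 * L) * (∫ s in Ioi ρ, ν s) + P * ∫ s in Ioi (ρ + L), ν s := fun ρ hρ ↦
    add_nonneg (mul_nonneg hM0 (hI0nn ρ hρ)) (mul_nonneg hP0 (hILnn ρ hρ))
  -- `w_key` at the source points of the outgoing identity (same retarded time `t - r`)
  have hwG : ∀ σ ∈ Icc 0 (min (t - T) (r - R₀)), |w (t - σ) (r - σ)| ≤
      N (u₀ - 2 * L) * (∫ s in Ioi (r - σ), ν s) + P * ∫ s in Ioi (r - σ + L), ν s := by
    intro σ hσ
    have h1 : σ ≤ t - T := hσ.2.trans (min_le_left _ _)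
    have h2 : σ ≤ r - R₀ := hσ.2.trans (min_le_right _ _)
    exact w_key hν hνnn hνint hDc hDν hP hin hwslab hN hL (by linarith) (by linarith)
      (by linarith)
  have hi0 : IntervalIntegrable (fun ρ ↦ ∫ s in Ioi ρ, ν s) volume R₀ r := by
    apply AntitoneOn.intervalIntegrable
    rw [uIcc_of_le hr]
    exact hI0anti.mono Icc_subset_Ici_self
  have hiL : IntervalIntegrable (fun ρ ↦ ∫ s in Ioi (ρ + L), ν s) volume R₀ r := by
    apply AntitoneOn.intervalIntegrable
    rw [uIcc_of_le hr]
    exact hILanti.mono Icc_subset_Ici_self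
  have hd0 : ∫ ρ in R₀..r, (∫ s in Ioi ρ, ν s) ≤ ∫ s in Ioi R₀, (s - R₀) * ν s := by
    simpa only [add_zero] using hdouble 0 r le_rfl hr
  have hdL := hdouble L r hL hr
  calc |φ t r|
      ≤ ∫ ρ in R₀..r, (N (u₀ - 2 * L) * (∫ s in Ioi ρ, ν s) + P * ∫ s in Ioi (ρ + L), ν s) :=
        phi_estimate hwc hout hφslab hφcyl ht hr hGanti hGnn hwG
    _ = N (u₀ - 2 * L) * (∫ ρ in R₀..r, ∫ s in Ioi ρ, ν s) +
          P * ∫ ρ in R₀..r, ∫ s in Ioi (ρ + L), ν s := by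
        rw [intervalIntegral.integral_add (hi0.const_mul _) (hiL.const_mul _),
          intervalIntegral.integral_const_mul, intervalIntegral.integral_const_mul]
    _ ≤ N (u₀ - 2 * L) * (∫ s in Ioi R₀, (s - R₀) * ν s) +
          P * ∫ s in Ioi (R₀ + L), (s - R₀) * ν s := by
        gcongr

/-- **The retarded-time supremum tends to zero.**  If `N` is the retarded-time supremum of `|ψ|`
(minimal, nonnegative, antitone), `φ = ψ - χ` obeys the key inequality
`|φ t r| ≤ N (u₀ - 2L) η₀ + P τ (R₀ + L)` on `Ω ∩ {u₀ ≤ t - r}` with `0 ≤ η₀ < 1`, `τ → 0` at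
`+∞`, and `χ` is eventually small beyond every retarded time, then `N u ≤ ε` for `u` large:
`ℓ = inf N` satisfies `ℓ ≤ 2δ + (ℓ + δ) η₀` for all `δ > 0`, whence `ℓ (1 - η₀) ≤ 0`. -/
theorem sup_decay {T R₀ P η₀ : ℝ} {ψ χ φ : ℝ → ℝ → ℝ} {N τ : ℝ → ℝ}
    (hφ : ∀ t r, φ t r = ψ t r - χ t r)
    (hNle : ∀ u B, 0 ≤ B → (∀ t r, T ≤ t → R₀ ≤ r → u ≤ t - r → |ψ t r| ≤ B) → N u ≤ B)
    (hNnn : ∀ u, 0 ≤ N u) (hNanti : Antitone N)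
    (hη₀ : 0 ≤ η₀) (hη₁ : η₀ < 1) (hτ : Tendsto τ atTop (𝓝 0))
    (hkey : ∀ u₀ L t r, 0 ≤ L → T ≤ t → R₀ ≤ r → u₀ ≤ t - r →
      |φ t r| ≤ N (u₀ - 2 * L) * η₀ + P * τ (R₀ + L))
    (hχdec : ∀ ε > 0, ∃ u₀ : ℝ, ∀ t r, T ≤ t → R₀ ≤ r → u₀ ≤ t - r → |χ t r| ≤ ε) :
    ∀ ε > 0, ∃ u, N u ≤ ε := by
  have hbdd : BddBelow (range N) := ⟨0, by rintro _ ⟨u, rfl⟩; exact hNnn u⟩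
  have hℓle : ∀ u, (⨅ u, N u) ≤ N u := fun u ↦ ciInf_le hbdd u
  -- main inequality
  have hmain : ∀ δ > 0, (⨅ u, N u) ≤ 2 * δ + ((⨅ u, N u) + δ) * η₀ := by
    intro δ hδ
    have hPτ : Tendsto (fun a ↦ P * τ a) atTop (𝓝 0) := by
      simpa only [mul_zero] using hτ.const_mul P
    obtain ⟨A, hA⟩ := eventually_atTop.1 ((tendsto_order.1 hPτ).2 δ hδ)
    have hL : 0 ≤ max (A - R₀) 0 := le_max_right _ _
    have hτL : P * τ (R₀ + max (A - R₀) 0) < δ := hA _ (by linarith [le_max_left (A - R₀) 0])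
    obtain ⟨u₂, hu₂⟩ := hχdec δ hδ
    obtain ⟨u₁, hu₁⟩ : ∃ u₁, N u₁ < (⨅ u, N u) + δ := exists_lt_of_ciInf_lt (by linarith)
    have hle₁ : N (max (u₁ + 2 * max (A - R₀) 0) u₂ - 2 * max (A - R₀) 0) ≤ N u₁ :=
      hNanti (by linarith [le_max_left (u₁ + 2 * max (A - R₀) 0) u₂])
    have hB : N (max (u₁ + 2 * max (A - R₀) 0) u₂) ≤ 2 * δ + ((⨅ u, N u) + δ) * η₀ := by
      refine hNle _ _ (add_nonneg (by linarith) (mul_nonneg (by linarith [hNnn u₁]) hη₀))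
        fun t r ht hr hu ↦ ?_
      have hχ : |χ t r| ≤ δ := hu₂ t r ht hr ((le_max_right _ _).trans hu)
      have hφb := hkey _ _ t r hL ht hr hu
      have hψ : |ψ t r| ≤ |χ t r| + |φ t r| := by
        rw [show ψ t r = χ t r + φ t r by rw [hφ]; ring]
        exact abs_add_le _ _
      have hmul : N (max (u₁ + 2 * max (A - R₀) 0) u₂ - 2 * max (A - R₀) 0) * η₀ ≤
          ((⨅ u, N u) + δ) * η₀ :=
        mul_le_mul_of_nonneg_right (hle₁.trans hu₁.le) hη₀
      linarith
    exact (hℓle _).trans hB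
  -- hence `ℓ (1 - η₀) ≤ 3δ` for every `δ > 0`, so `ℓ ≤ 0`
  have h3 : ∀ δ > 0, (⨅ u, N u) * (1 - η₀) ≤ 3 * δ := by
    intro δ hδ
    have h := hmain δ hδ
    have hδη : δ * η₀ < δ := mul_lt_of_lt_one_right hδ hη₁
    nlinarith
  have hℓ : (⨅ u, N u) ≤ 0 := by
    refine not_lt.1 fun h ↦ ?_
    have hpos : 0 < (⨅ u, N u) * (1 - η₀) := mul_pos h (by linarith)
    have := h3 ((⨅ u, N u) * (1 - η₀) / 6) (by positivity)
    linarith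
  intro ε hε
  obtain ⟨u, hu⟩ : ∃ u, N u < ε := exists_lt_of_ciInf_lt (lt_of_le_of_lt hℓ hε)
  exact ⟨u, hu.le⟩

/-- **Core of the no-parking rung** for abstract `φ = ψ - χ`, `w`, `z`, `D` subject to the
conclusions of the characteristic calculus (transport identities, data facts), `|D| ≤ ν |ψ|` on
`Ω`, the conclusions of the Tonelli rung for `ν`, Bargmann norm `< 1`, the a-priori bound
`|ψ| ≤ P` on `Ω` and the decay of `χ`: beyond large retarded times `|ψ|, |w|, |z| ≤ ε`. -/
theorem noParking_core {T R₀ P : ℝ} {ν : ℝ → ℝ} {ψ χ φ w z D : ℝ → ℝ → ℝ}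
    (hφ : ∀ t r, φ t r = ψ t r - χ t r)
    (hwc : Continuous (uncurry w)) (hDc : Continuous (uncurry D))
    (hin : ∀ t r a : ℝ, w t r = w (t - a) (r + a) + ∫ s in (0 : ℝ)..a, D (t - s) (r + s))
    (hout : ∀ t r a : ℝ, φ t r = φ (t - a) (r - a) + ∫ s in (0 : ℝ)..a, w (t - s) (r - s))
    (houtz : ∀ t r a : ℝ, z t r = z (t - a) (r - a) + ∫ s in (0 : ℝ)..a, D (t - s) (r - s))
    (hs : ∀ r, R₀ ≤ r → φ T r = 0 ∧ w T r = 0 ∧ z T r = 0)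
    (hc : ∀ t, T ≤ t → φ t R₀ = 0 ∧ z t R₀ = -w t R₀)
    (hDν : ∀ t r, T ≤ t → R₀ ≤ r → |D t r| ≤ ν r * |ψ t r|)
    (hν : ContinuousOn ν (Ici R₀)) (hνnn : ∀ s, R₀ ≤ s → 0 ≤ ν s)
    (hνint : IntegrableOn ν (Ioi R₀))
    (hIanti : ∀ L, 0 ≤ L → AntitoneOn (fun ρ ↦ ∫ s in Ioi (ρ + L), ν s) (Ici R₀))
    (hdouble : ∀ L r, 0 ≤ L → R₀ ≤ r →
      ∫ ρ in R₀..r, (∫ s in Ioi (ρ + L), ν s) ≤ ∫ s in Ioi (R₀ + L), (s - R₀) * ν s)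
    (htailν : Tendsto (fun a ↦ ∫ s in Ioi a, ν s) atTop (𝓝 0))
    (htailw : Tendsto (fun a ↦ ∫ s in Ioi a, (s - R₀) * ν s) atTop (𝓝 0))
    (hη : ∫ s in Ioi R₀, (s - R₀) * ν s < 1)
    (hP : ∀ t r, T ≤ t → R₀ ≤ r → |ψ t r| ≤ P)
    (hχdec : ∀ ε > 0, ∃ u₀ : ℝ, ∀ t r, T ≤ t → R₀ ≤ r → u₀ ≤ t - r → |χ t r| ≤ ε) :
    ∀ ε > 0, ∃ u₀ : ℝ, ∀ t r, T ≤ t → R₀ ≤ r → u₀ ≤ t - r →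
      |ψ t r| ≤ ε ∧ |w t r| ≤ ε ∧ |z t r| ≤ ε := by
  intro ε hε
  have hP0 : 0 ≤ P := (abs_nonneg _).trans (hP T R₀ le_rfl le_rfl)
  obtain ⟨N, hN, hNnn, hNanti, hNle⟩ := exists_retardedSup ψ T R₀ P hP
  have hwslab : ∀ r, R₀ ≤ r → w T r = 0 := fun r hr ↦ (hs r hr).2.1
  have hI₀ : 0 ≤ ∫ s in Ioi R₀, ν s :=
    setIntegral_nonneg measurableSet_Ioi fun s (hs : R₀ < s) ↦ hνnn s hs.le
  have hη₀ : 0 ≤ ∫ s in Ioi R₀, (s - R₀) * ν s :=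
    setIntegral_nonneg measurableSet_Ioi fun s (hs : R₀ < s) ↦
      mul_nonneg (sub_nonneg.2 hs.le) (hνnn s hs.le)
  -- (i) incoming estimate with both tails taken at `R₀`
  have hwk : ∀ u₀ L t r, 0 ≤ L → T ≤ t → R₀ ≤ r → u₀ ≤ t - r →
      |w t r| ≤ N (u₀ - 2 * L) * (∫ s in Ioi R₀, ν s) + P * ∫ s in Ioi (R₀ + L), ν s := by
    intro u₀ L t r hL ht hr hu
    have h1 : ∫ s in Ioi r, ν s ≤ ∫ s in Ioi R₀, ν s := by
      simpa only [add_zero] using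
        hIanti 0 le_rfl self_mem_Ici (show r ∈ Ici R₀ from hr) hr
    have h2 : ∫ s in Ioi (r + L), ν s ≤ ∫ s in Ioi (R₀ + L), ν s :=
      hIanti L hL self_mem_Ici (show r ∈ Ici R₀ from hr) hr
    have h := w_key hν hνnn hνint hDc hDν hP hin hwslab hN hL ht hr hu
    have hN0 := hNnn (u₀ - 2 * L)
    calc |w t r| ≤ N (u₀ - 2 * L) * (∫ s in Ioi r, ν s) + P * ∫ s in Ioi (r + L), ν s := h
      _ ≤ N (u₀ - 2 * L) * (∫ s in Ioi R₀, ν s) + P * ∫ s in Ioi (R₀ + L), ν s := by gcongr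
  -- (ii)+(iii) the supremum decays
  have hdecay : ∀ ε > 0, ∃ u, N u ≤ ε :=
    sup_decay (τ := fun a ↦ ∫ s in Ioi a, (s - R₀) * ν s) hφ hNle hNnn hNanti hη₀ hη htailw
      (fun u₀ L t r hL ht hr hu ↦ phi_key hν hνnn hνint hwc hDc hDν hP hin hout hwslab
        (fun r hr ↦ (hs r hr).1) (fun t ht ↦ (hc t ht).1) hIanti hdouble hN hNnn hL ht hr hu)
      hχdec
  -- choice of `L`, then of the retarded time
  have hPt : Tendsto (fun a ↦ P * ∫ s in Ioi a, ν s) atTop (𝓝 0) := by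
    simpa only [mul_zero] using htailν.const_mul P
  obtain ⟨A, hA⟩ := eventually_atTop.1 ((tendsto_order.1 hPt).2 (ε / 4) (by positivity))
  obtain ⟨L, hL, hAL⟩ : ∃ L, 0 ≤ L ∧ A ≤ R₀ + L :=
    ⟨max (A - R₀) 0, le_max_right _ _, by linarith [le_max_left (A - R₀) 0]⟩
  have hτL : P * ∫ s in Ioi (R₀ + L), ν s < ε / 4 := hA _ hAL
  have hI1 : (0:ℝ) < (∫ s in Ioi R₀, ν s) + 1 := by linarith
  obtain ⟨ua, hua⟩ := hdecay (ε / 4 / ((∫ s in Ioi R₀, ν s) + 1)) (by positivity)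
  obtain ⟨ub, hub⟩ := hdecay ε hε
  have hsmall : ∀ x, x ≤ ε / 4 / ((∫ s in Ioi R₀, ν s) + 1) →
      x * (∫ s in Ioi R₀, ν s) ≤ ε / 4 := by
    intro x hx
    calc x * (∫ s in Ioi R₀, ν s) ≤ ε / 4 / ((∫ s in Ioi R₀, ν s) + 1) * ∫ s in Ioi R₀, ν s :=
          mul_le_mul_of_nonneg_right hx hI₀
      _ ≤ ε / 4 / ((∫ s in Ioi R₀, ν s) + 1) * ((∫ s in Ioi R₀, ν s) + 1) :=
          mul_le_mul_of_nonneg_left (by linarith) (by positivity)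
      _ = ε / 4 := div_mul_cancel₀ _ hI1.ne'
  set u₀ := max (ua + 2 * L) ub
  have hua' : ua ≤ u₀ - 2 * L := by linarith [le_max_left (ua + 2 * L) ub]
  have hNa : N (u₀ - 2 * L) * (∫ s in Ioi R₀, ν s) ≤ ε / 4 :=
    hsmall _ ((hNanti hua').trans hua)
  have hNb : N u₀ * (∫ s in Ioi R₀, ν s) ≤ ε / 4 :=
    hsmall _ ((hNanti (by linarith)).trans ((hNanti hua').trans hua))
  -- `|w| ≤ ε / 2` at every point of `Ω` of retarded time `≥ u₀`
  have hwU : ∀ t r, T ≤ t → R₀ ≤ r → u₀ ≤ t - r → |w t r| ≤ ε / 2 := by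
    intro t r ht hr hu
    have := hwk u₀ L t r hL ht hr hu
    linarith
  refine ⟨u₀, fun t r ht hr hu ↦ ⟨?_, (hwU t r ht hr hu).trans (by linarith), ?_⟩⟩
  · exact (hN _ t r ht hr hu).trans ((hNanti (le_max_right _ _)).trans hub)
  · have hz := z_estimate hν hνnn hνint hDc hDν houtz (fun r hr ↦ (hs r hr).2.2)
      (fun t ht ↦ (hc t ht).2) ht hr (B := ε / 2) (K := N u₀)
      (fun σ hσ ↦ hwU _ _ (by linarith [hσ.2, min_le_left (t - T) (r - R₀)])
        (by linarith [hσ.2, min_le_right (t - T) (r - R₀)]) (by linarith))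
      (fun σ hσ ↦ hN _ _ _ (by linarith [hσ.2, min_le_left (t - T) (r - R₀)])
        (by linarith [hσ.2, min_le_right (t - T) (r - R₀)]) (by linarith))
    linarith

/-- Registered stub M2 of the line `bargmann-small-late-exterior` (statement
`TonelliBargmann → CharacteristicCalculus → NoParkingDecay`, all three unfolded verbatim).
Granted the Tonelli rung (hypothesis 1, used for `ν`, which is `≥ |V T ·| ≥ 0` on `[R₀, ∞)`) and
the characteristic calculus (hypothesis 2, used for `ψ, χ`): with `φ = ψ − χ`,
`w = φ_t + φ_r`, `z = φ_t − φ_r`, `D = φ_tt − φ_rr = −Vψ` on `Ω` (the two equations), so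
`|D| ≤ ν |ψ|` there, `noParking_core` gives `|ψ|, |w|, |z| ≤ ε` beyond a retarded time `u₀`,
and `φ_t = (w + z)/2`, `φ_r = (w − z)/2`. -/
theorem stub_noParkingDecay :
  (∀ (R₀ : ℝ) (ν : ℝ → ℝ), ContinuousOn ν (Set.Ici R₀) → (∀ s, R₀ ≤ s → 0 ≤ ν s) →
      IntegrableOn (fun s ↦ (s - R₀) * ν s) (Set.Ioi R₀) →
      IntegrableOn ν (Set.Ioi R₀) ∧
      (∀ L ρ, 0 ≤ L → R₀ ≤ ρ → 0 ≤ ∫ s in Set.Ioi (ρ + L), ν s) ∧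
      (∀ L, 0 ≤ L → AntitoneOn (fun ρ ↦ ∫ s in Set.Ioi (ρ + L), ν s) (Set.Ici R₀)) ∧
      (∀ L r, 0 ≤ L → R₀ ≤ r →
        ∫ ρ in R₀..r, (∫ s in Set.Ioi (ρ + L), ν s) ≤ ∫ s in Set.Ioi (R₀ + L), (s - R₀) * ν s) ∧
      Tendsto (fun a ↦ ∫ s in Set.Ioi a, ν s) atTop (𝓝 0) ∧
      Tendsto (fun a ↦ ∫ s in Set.Ioi a, (s - R₀) * ν s) atTop (𝓝 0)) →
  (∀ (T R₀ : ℝ) (ψ χ : ℝ → ℝ → ℝ),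
      ContDiff ℝ 2 (Function.uncurry ψ) → ContDiff ℝ 2 (Function.uncurry χ) →
      (∀ r, R₀ ≤ r → χ T r = ψ T r ∧ deriv (fun s ↦ χ s r) T = deriv (fun s ↦ ψ s r) T) →
      (∀ t, T ≤ t → χ t R₀ = ψ t R₀) →
      let φ : ℝ → ℝ → ℝ := fun t r ↦ ψ t r - χ t r
      let w : ℝ → ℝ → ℝ := fun t r ↦
        deriv (fun s ↦ ψ s r - χ s r) t + deriv (fun s ↦ ψ t s - χ t s) r
      let z : ℝ → ℝ → ℝ := fun t r ↦
        deriv (fun s ↦ ψ s r - χ s r) t - deriv (fun s ↦ ψ t s - χ t s) r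
      let D : ℝ → ℝ → ℝ := fun t r ↦
        (iteratedDeriv 2 (fun s ↦ ψ s r) t - iteratedDeriv 2 (ψ t) r) -
          (iteratedDeriv 2 (fun s ↦ χ s r) t - iteratedDeriv 2 (χ t) r)
      Continuous (Function.uncurry φ) ∧ Continuous (Function.uncurry w) ∧
        Continuous (Function.uncurry z) ∧ Continuous (Function.uncurry D) ∧
      (∀ t r a : ℝ, w t r = w (t - a) (r + a) + ∫ s in (0 : ℝ)..a, D (t - s) (r + s)) ∧
      (∀ t r a : ℝ, φ t r = φ (t - a) (r - a) + ∫ s in (0 : ℝ)..a, w (t - s) (r - s)) ∧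
      (∀ t r a : ℝ, z t r = z (t - a) (r - a) + ∫ s in (0 : ℝ)..a, D (t - s) (r - s)) ∧
      (∀ r, R₀ ≤ r → φ T r = 0 ∧ w T r = 0 ∧ z T r = 0) ∧
      (∀ t, T ≤ t → φ t R₀ = 0 ∧ z t R₀ = -w t R₀)) →
  ∀ (T R₀ η P : ℝ) (ν : ℝ → ℝ) (V ψ χ : ℝ → ℝ → ℝ),
    0 ≤ R₀ → η < 1 →
    ContinuousOn ν (Set.Ici R₀) →
    IntegrableOn (fun s ↦ (s - R₀) * ν s) (Set.Ioi R₀) →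
    (∫ s in Set.Ioi R₀, (s - R₀) * ν s) ≤ η →
    (∀ t r, T ≤ t → R₀ ≤ r → |V t r| ≤ ν r) →
    ContDiff ℝ 2 (Function.uncurry ψ) → ContDiff ℝ 2 (Function.uncurry χ) →
    (∀ t r, T ≤ t → R₀ ≤ r →
      iteratedDeriv 2 (fun s ↦ ψ s r) t - iteratedDeriv 2 (ψ t) r + V t r * ψ t r = 0) →
    (∀ t r, T ≤ t → R₀ ≤ r → iteratedDeriv 2 (fun s ↦ χ s r) t - iteratedDeriv 2 (χ t) r = 0) →
    (∀ r, R₀ ≤ r → χ T r = ψ T r ∧ deriv (fun s ↦ χ s r) T = deriv (fun s ↦ ψ s r) T) →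
    (∀ t, T ≤ t → χ t R₀ = ψ t R₀) →
    (∀ t r, T ≤ t → R₀ ≤ r → |ψ t r| ≤ P) →
    (∀ ε > 0, ∃ u₀ : ℝ, ∀ t r, T ≤ t → R₀ ≤ r → u₀ ≤ t - r → |χ t r| ≤ ε) →
    ∀ ε > 0, ∃ u₀ : ℝ, ∀ t r, T ≤ t → R₀ ≤ r → u₀ ≤ t - r →
      |ψ t r| ≤ ε ∧ |deriv (fun s ↦ ψ s r - χ s r) t| ≤ ε ∧ |deriv (fun s ↦ ψ t s - χ t s) r| ≤ ε := by
  intro hR1 hR2 T R₀ η P ν V ψ χ _ hη hν hint hηle hV hψ hχ hψeq hχeq hslab hcyl hP hχdec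
  -- rung R1 for `ν` (`ν ≥ |V T ·| ≥ 0` on `[R₀, ∞)`)
  have hνnn : ∀ s, R₀ ≤ s → 0 ≤ ν s := fun s hs ↦ (abs_nonneg _).trans (hV T s le_rfl hs)
  obtain ⟨hνint, -, hIanti, hdouble, htailν, htailw⟩ := hR1 R₀ ν hν hνnn hint
  -- rung R2 for `ψ, χ`
  have h2 := hR2 T R₀ ψ χ hψ hχ hslab hcyl
  extract_lets φ w z D at h2
  obtain ⟨-, hwc, -, hDc, hin, hout, houtz, hs, hc⟩ := h2
  -- the source term: `D = -Vψ` on `Ω`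
  have hDν : ∀ t r, T ≤ t → R₀ ≤ r → |D t r| ≤ ν r * |ψ t r| := by
    intro t r ht hr
    have h1 := hψeq t r ht hr
    have h2 := hχeq t r ht hr
    have hD : D t r = -(V t r * ψ t r) := by
      simp only [D]
      linarith
    rw [hD, abs_neg, abs_mul]
    exact mul_le_mul_of_nonneg_right (hV t r ht hr) (abs_nonneg _)
  have hcore := noParking_core (φ := φ) (fun t r ↦ rfl) hwc hDc hin hout houtz hs hc hDν hν
    hνnn hνint hIanti hdouble htailν htailw (lt_of_le_of_lt hηle hη) hP hχdec
  intro ε hε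
  obtain ⟨u₀, hu₀⟩ := hcore ε hε
  refine ⟨u₀, fun t r ht hr hu ↦ ?_⟩
  obtain ⟨h1, h2, h3⟩ := hu₀ t r ht hr hu
  have hw : w t r = deriv (fun s ↦ ψ s r - χ s r) t + deriv (fun s ↦ ψ t s - χ t s) r := rfl
  have hz : z t r = deriv (fun s ↦ ψ s r - χ s r) t - deriv (fun s ↦ ψ t s - χ t s) r := rfl
  refine ⟨h1, ?_, ?_⟩
  · rw [show deriv (fun s ↦ ψ s r - χ s r) t = (w t r + z t r) / 2 by rw [hw, hz]; ring,
      abs_div, abs_two]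
    linarith [abs_add_le (w t r) (z t r)]
  · rw [show deriv (fun s ↦ ψ t s - χ t s) r = (w t r - z t r) / 2 by rw [hw, hz]; ring,
      abs_div, abs_two]
    linarith [abs_sub (w t r) (z t r)]

end Summit.FinalStateConjecture.FinalStateConjecture.Theorems.NecksCertifyBargmann.NoParking
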